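import Mathlib
import HarnessLib
import HarnessLib.Audit
import Summits.RiemannHypothesis.Statement
import Summits.RiemannHypothesis.RiemannHypothesis.Theorems.LiHeightLawLogDefs
import Summits.RiemannHypothesis.RiemannHypothesis.Theorems.LiAsymptoticDefs
import Literature.NumberTheory.LFunctions.KeiperLiPositivityUpTo
import Literature.NumberTheory.LFunctions.Equivalents
import Literature.NumberTheory.DiophantineGeometry.NamedHypotheses
import HarnessLib.Audit.Status.Attr

/-!
Route: LiHeightLog

CLOSED (proved) 2026-08-26T14:13:55Z by operator:999:1355527 — reason: proved:Summit.RiemannHypothesis.RiemannHypothesis.Theorems.LiTheory.liHeightLawLog_holds — note: gate5 operator (D-0092): kernel-checked PROVED close for director-rh / rh-li-log. The file is kept as the record of this route; refuted decls are indexed as negative knowledge (`ledger negatives`).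

# Route LiHeightLog — RH-free Li height law in Brown's logarithmic range — RH verified to T ≥ 1000 ⇒
λ_n ≥ 0 for n ≤ 2T² log T, by the cosh defect and zero counting alone

Column LI of the RH ladder (D-0040/D-0059/D-0061), theory round 6: the route closes the RUNG LEAF
«Li HEIGHT LAW,
LOGARITHMIC RANGE» `LiTheory.LiHeightLawLog` (RH-FREE, PROOF-OF-DATA): for every T ≥ 1000 with
`RiemannHypothesisUpTo T`
(all zeros of ζ with 0 < Im ρ ≤ T on the line) and every 1 ≤ n ≤ 2T² log T, `0 ≤ keiperLiCoeff n` —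
Brown's printed
range (J. Number Theory 111 (2005) Thm 2, T₀ inexplicit, proof incomplete: Droll 2012 Conj.
1.7.10/§5, Palojärvi 2020 §1)
with the explicit threshold T₀ = 1000; the tree proves n ≤ T²/5 (L-P(P1)) and the asymptotic law on
n ≤ T²/4 (L-P(P1⁺)).
It suffices to show X = LiBoxCosh ∧ LiCoshTailCount ∧ LiHeightBudgetLog (+ the Assembly item,
provable now): pairing the
zeros above T as {ρ, 1 − ρ̄} (reciprocal moduli r, 1/r, COMMON phase φ) the pair differs from the
trace 2 m f_n(γ) by at
most m[(rⁿ + r⁻ⁿ − 2) + n/(2γ³)] ≤ m[liCoshWeight n γ + n/(2γ³)] with NO restriction on n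
(LiBoxCosh); the modulus defect
is summed by zero COUNTING alone, Σ_{T<γ≤U} m·liCoshWeight n γ ≤ liCoshTail n T = (cosh(n/2T²) −
1)(T(log(T/2π)+1)/π +
1.24 log T + 18) (LiCoshTailCount, RH-free); everything else is route LiAsymptotic's PROVED
machinery (window above √n:
LiSmoothMainTerm, LiOscillatoryS plain form, LiLowZerosTrivial, LiFarZeroTailCube,
LiAsymptoticBudget at T₁ = max(1000, 2√n)),
giving the ALL-RANGE law |λ_n − (n/2)log n − C₁n| ≤ 2√n log n + liCoshDefect n T for every n ≥ 900
(Assembly); the closed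
inequality 2√n log n + liCoshDefect n T < liMainTerm n on 900 ≤ n ≤ 2T² log T (LiHeightBudgetLog)
and the tree's
`keiperLiCoeff_nonneg_of_riemannHypothesisUpTo` (n ≤ 2π(T − 4)) for n < 900 give the leaf.
Lean: `Summit.RiemannHypothesis.RiemannHypothesis.Theorems.LiTheory.LiHeightLawLog`

## Assembly
The two new estimates feed the PROVED finite-height machinery of route LiAsymptotic: for T′ ≥ max(T,
n²), Re Σ_{liZeroBox T′} =

CLOSES_TARGET: closes rung L-P(P1-log) of RiemannHypothesis: Summit.RiemannHypothesis.RiemannHypothesis.Theorems.LiTheory.LiHeightLawLog (D-0061; not the summit Statement) — the deciding theorem of this route concludes that registered leaf instead of the Statement decl `RiemannHypothesis` (class rung: servable and labelled, never counted as concluding the summit Statement).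

Rationale: WHY THIS LINE. Rung L-P(P1⁺) (route LiAsymptotic) is CLOSED·proved: the tree proves |λ_n − (n/2)log
n − C₁n| ≤ 2√n log n for 900 ≤ n ≤
T²/4 from RH verified to T, and its only n-restricted step is the two-sided far-pair comparison
|pair − 2m f_n| ≤
m(2.82n²/γ⁴ + n/2γ³) (needs n ≤ γ²/4 so that (1 − 1/ρ)ⁿ stays bounded).  The new line keeps the
whole window machinery and
replaces that one step by the exact pair structure: for a reflected pair the two moduli are r and
1/r with the SAME argument,
so the comparison error is the COSH DEFECT rⁿ + r⁻ⁿ − 2 ≤ G_n(γ) = (1+γ⁻²)^{n/2} + (1+γ⁻²)^{−n/2} −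
2 (Brown's g, Lemma 5
of Brown2005LiCriterion = doi:10.1016/j.jnt.2004.07.016) plus the unchanged phase term; G_n is
summed against the explicit
counting function by Stieltjes integration and one integration by parts (not by Brown's power
series, whose termwise
positivity fails: Droll 2012 thesis §5 pp.101–102, lit key paper:w2187263254), giving (cosh(n/2T²) −
1)·(T/π)(log(T/2π)+1)(1+o(1)),
which the main term (n/2)log n beats exactly up to n ≈ 2T² log T (float margin ≥ 100 at the edge of
Brown's range for
every T ≥ 1000, r6_check.py).  Imported from another area: nothing — classical explicit zero
counting; the point of the
rung is that Brown's printed-but-unproved range becomes a theorem with an explicit T₀, RH-free, and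
that c = 2 is the
COUNTING-sharp constant (dossier README-R6 §5: an admissible multiset with ≍ log T zeros at height
T⁺ off the line defeats
any c > 2 from counting alone; c = 4 is the ceiling with density input).  Prior routes:
LiCoefficients (n ≤ T²/5, one-sided
window below T), LiAsymptotic (n ≤ T²/4, two-sided law) — both quadratic; the negatives index has
nothing on Li coefficients.

RANKED CRUXES. #2 LiCoshTailCount (crux) — (N2, deciding, RH-FREE) the COSH TAIL COUNT: for 1000 ≤ T
≤ U and every n, Σ_{ρ ∈ zerosBetween T U} m(ρ)·liCoshWeight n (Im ρ) ≤ liCoshTail n T, where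
liCoshWeight n t = (1+1/t²)^{n/2} + (1+1/t²)^{−n/2} − 2 (Brown's g) and liCoshTail n T =
(cosh(n/(2T²)) − 1)·(T(log(T/2π) + 1)/π + 1.24 log T + 18): G_n decreasing with G_n ≤ 2φ_n, φ_n(t) =
cosh(n/2t²) − 1, partial summation (`sum_zerosBetween_le_of_count_le`) against N(t) − N(T) ≤ M(t) −
M(T) + 2(0.3083 log t + 4.128) (`abs_zetaZeroCount_sub_main_le_explicit`), then 2φ ≤ −tφ′ and one
integration by parts (∫_T^∞ 2φM′ ≤ Tφ(T)(log(T/2π)+1)/π). [difficulty: M] (why it might fail: the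
IBP needs φ_n(t)(t log t) → 0 and 2φ ≤ −tφ′ uniformly in n (true: cosh s − 1 ≤ s sinh s), and the
Stieltjes step over the step function N(t) with the two-sided remainder at ordinates; constants
1.24/18 carry only 0.007 log T + 0.87 of slack over the derivation's 1.2332 log T + 17.13.)
[Brown2005LiCriterion, doi:10.1016/j.jnt.2004.07.016, paper:w2187263254, arXiv:1807.01506,
tree:Literature/NumberTheory/LFunctions/ZetaArgBacklundExplicit.lean,
tree:Literature/NumberTheory/LFunctions/SchoenfeldZeroSums.lean]
#3 LiBoxCosh (crux) — (K1⁺) the COSH BOX COMPARISON: under RH up to T (4 ≤ T ≤ T′) and for EVERY n,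
|Re Σ_{ρ ∈ liZeroBox T′} m(1 − (1 − 1/ρ)ⁿ) − 2Σ_{0 < Im ρ ≤ T′} m f_n(Im ρ)| ≤ Σ_{T < Im ρ ≤ T′}
m·liCoshWeight n (Im ρ) + (n/2)Σ_{T < Im ρ ≤ T′} m/(Im ρ)³: below T every zero is on the line and
contributes m f_n exactly; above T the reflected pair {ρ, 1 − ρ̄} has moduli r, 1/r (|1 − 1/ρ|·|1 −
1/(1 − ρ̄)| = 1) and a common phase φ with |φ − θ(γ)| ≤ (Re ρ − ½)²/γ³ (tree angle lemma), so |pair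
− 2m f_n| ≤ m[(rⁿ + r⁻ⁿ − 2) + 2n|φ − θ|] ≤ m[liCoshWeight n γ + n/(2γ³)] (r^{±2} ≤ 1 + 1/γ² for 0 ≤
Re ρ ≤ 1); the K1b bookkeeping `re_boxSum_eq` of LiAsymptoticLiBoxTwoSided.lean is reused verbatim.
[difficulty: M] (why it might fail: r² ≤ 1 + 1/γ² needs 0 ≤ Re ρ ≤ 1 threaded from `zerosBetween`
membership (as in `liBoxTwoSided_bound`); the common-phase identity arg(1 − 1/ρ) = arg(1 − 1/(1 −
ρ̄)) needs principal-branch bookkeeping of `Complex.arg` (safe: Re(1 − 1/ρ) > 0 for |ρ| ≥ 4).)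
[BombieriLagarias1999, Brown2005LiCriterion,
tree:Summits/RiemannHypothesis/RiemannHypothesis/Theorems/LiAsymptoticBoxTwoSidedPair.lean,
tree:Summits/RiemannHypothesis/RiemannHypothesis/Theorems/LiAsymptoticLiBoxTwoSided.lean]
#4 LiHeightBudgetLog (crux) — (K4″) the closed BUDGET of the logarithmic range: for 1000 ≤ T, 900 ≤
n ≤ 2T² log T, 2√n log n + liCoshDefect n T < liMainTerm n = (n/2)log n + C₁n (C₁ = −1.1303…); split
at n = T²: below, cosh x − 1 ≤ 0.55x² (x = n/2T² ≤ ½) makes the defect ≤ 0.05(n/T)log T; above, cosh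
x − 1 ≤ eˣ/2 ≤ T/2 (x ≤ log T) makes it ≤ T²(log T + 1)/(2π)·1.01 against (n/2)log n − 1.14n − 2√n
log n ≥ 0.8·T² log T. [difficulty: S] (why it might fail: two-variable inequality with cosh(n/2T²)
up to T/2, checked only on a float grid (r6_check.py (3): min (main − band − defect)/main = 0.80 at
n = 900; main/defect ≥ 100 at n = 2T² log T, T ∈ [10³, 10⁴⁰]); an interval pass could expose a
corner near n = 900 or T = 1000.) [Brown2005LiCriterion, Lagarias2007LiCoefficients,
tree:Summits/RiemannHypothesis/RiemannHypothesis/Theorems/LiAsymptoticDefs.lean]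

TWO-LAYER PLAN. LiCoshTailCount ⇐ stub_stieltjes_count (Σ ≤ 4E(T)φ_n(T) + ∫_T^U 2φ_n(M′ + 0.6166/t))
→ stub_ibp_tail (∫ ≤ φ_n(T)(T(log(T/2π)+1)/π + 0.6166)) → LiCoshTailCount (composition PROVED in
bc/LiCoshTailCount_birth.lean); LiBoxCosh ⇐ stub_pair_cosh (per reflected pair) → stub_box_reduction
(K1b bookkeeping with an arbitrary pair majorant) → LiBoxCosh; LiHeightBudgetLog ⇐ stub_budget_low
(n ≤ T²) → stub_budget_high (T² ≤ n ≤ 2T² log T); Assembly ⇐ stub_pointwise (finite height T′ ≥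
max(T, n²)) → stub_limit.  Nothing filed as children now.

KILL CRITERIA. A refutation of LiCoshTailCount at some (n, T, U) with the tree's counting constants
(a certified zero table showing Σ_{T<γ≤U} G_n(γ) > liCoshTail n T) closes the route
`refuted:LiCoshTailCount` unless the constants 1.24/18 merely need enlarging (then restate; the
budget has 100× room); a refutation of LiHeightBudgetLog forces a restate with a smaller range
constant (any c < 2 with margin) — the leaf would then be re-filed as LiHeightLawLog′ with that c,
not abandoned; a proof elsewhere of Brown's Thm 2 with explicit T₀ ≤ 1000 moots the route (cite it
as the leaf's proof).  An actual zero of ζ off the line below height 1000 is excluded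
(Platt–Trudgian), so the leaf cannot be vacuous-false.

NOT DECOMPOSED YET. The Assembly's interior (window split at √n, the T₁ = max(1000, 2√n) budget
instantiation, the T′ → ∞ limit) — it is a transfer of a PROVED proof; the monotonicity of
liCoshWeight in t and the inequality liCoshWeight n t ≤ 2(cosh(n/2t²) − 1) (inside
stub_stieltjes_count); the elementary inequalities cosh s − 1 ≤ s sinh s, cosh x − 1 ≤ 0.55x² (x ≤
½), cosh x − 1 ≤ eˣ/2 (inside the budget stubs); the exact principal-branch bookkeeping of the
common phase (inside stub_pair_cosh).  All are layer-2 material for provers (`--supports`), never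
items.

CHEAPEST FALSIFIER. Sum G_n(γ) over the certified zero table HOME/data/zeta_zeros_to_3000000.txt.gz
(5 765 984 zeros, Arb) for T ∈ {1000, 2000, 5000, 10⁴} and n = λT², λ ∈ [0.01, 4 log T], add the
analytic tail beyond the table, and compare with liCoshTail n T — RUN (r6_check.py (2), 4.4 s): sup
ratio 0.31 (bound holds with ≥ 3× room, 30× at the top of Brown's range); and the budget grid (3):
positive everywhere, margin ≥ 100 at n = 2T² log T.  CERTIFIED (author's Arb run, kit j253908, 484
s): over all 5 765 984 zeros γ ≤ 3·10⁶ plus the rigorous counting remainder, sup of the certified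
upper endpoint of (Σ G_n + tail)/liCoshTail = 0.31225 on T ∈ {1e3,3e3,1e4,3e4,1e5} × n ∈ {T²/4, T²,
4T², 1–4·T² log T} (35/35 < 1); budget point margins ≥ 0.9888 for n ≤ 2T² log T (README-R6 §10). An
independent referee replay is the column's DATA hook ET-R6 (eng-3 g2, kit tags rhdata+rhli, < 1
core-h).

NUMBERS. Brown 2005 Thm 2: n ≤ 2T² log T (T > T₀ inexplicit); Remark 1: necessary side n ≲ T³ log²
T.  Oesterlé (unpublished): n ≤ T².  Tree: LiHeightLawQuadratic n ≤ T²/5 (T ≥ 10⁵),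
LiAsymptoticLawQuadratic n ≤ T²/4 (T ≥ 10³), keiperLiCoeff_nonneg_of_plattTrudgian n ≤ 1.885·10¹³,
LiPositivityPlattTrudgian24 n ≤ 1.8·10²⁴.  This leaf at the Platt–Trudgian height T = 3 000 175 332
800: 2T² log T = 5.1719·10²⁶ ⇒ corollary LiPositivityPlattTrudgian26: λ_n ≥ 0 for n ≤ 5·10²⁶ (glue
PROVED: 28 ≤ log T).  Honest threshold of the typed budget: n* = 3.5 T² log T (T = 10³), 2.95 (10⁵),
2.43 (T_PT), 2.28 (10²⁰) → 2 T² log T (1 + o(1)); counting ceiling c = 2, density ceiling c = 4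
(README-R6 §5).

DEFINITION REQUESTS. None: liCoshWeight, liCoshTail, liCoshDefect, LiAsymptoticLawAllRange,
LiHeightLawLog, LiPositivityPlattTrudgian26 are typed in PART J `Theorems/LiHeightLawLogDefs.lean`
(statement-only, farm rc 0; to be landed by a prover/eng hand before birth, like PART C/H).

Novelty: Searches (2026-08-26): lit search "Li criterion verified height positivity range" / "Keiper Li
coefficients Brown theorem 2" / "Li coefficients cosh zeros height" (local corpus: Brown 2005, Droll
2012, Palojärvi 2020, Voros 2006, Suzuki 2023 held; remote OpenAlex/S2 rate-limited); lit citing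
doi:10.1016/j.jnt.2004.07.016 (24 citers to 2025, none proving Thm 2); lit vsearch books "sum over
zeta zeros of cosh weight by partial summation against the counting function" (0 relevant); lit
galaxy search "Li's criterion|Li coefficients|Keiper-Li" --star all (33 rows, none on finite-height
ranges); lean search/grep tree: LiCoefficientsDefs l.78/121/129–131 and KeiperLiPositivityUpTo
docstring record Brown's range OPEN.
Nearest prior art found: Brown2005LiCriterion = doi:10.1016/j.jnt.2004.07.016 Thm 2 + Lemma 5 (the
range, printed with an incomplete proof); paper:w2187263254 (Droll 2012) Conj. 1.7.10 and §5
(identifies the gap); arXiv:1807.01506 (Palojärvi 2020) §1 («left unproved»); arXiv:math/0506326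
(Voros 2006) §3 (detectability heuristic |Im ρ| ≲ √(n/2), Oesterlé's n ≤ T²); tree routes
LiCoefficients / LiAsymptotic (quadratic ranges).
Delta: Brown's logarithmic range becomes an RH-free theorem with explicit T₀ = 1000 by separating
modulus and phase of the reflected pair exactly (reciprocal moduli, common phase) and summing the
cosh defect by Stieltjes integration against the explicit counting function instead of Brown's
termwise power series — the step Droll showed invalid — on t  [refs: 10.1016/j.jnt.2004.07.016, 1807.01506, math/0506326, doi:10.1016/j.jnt.2004.07.016, paper:w2187263254]

Barriers (technique_class: explicit-window, zero-counting, cosh-defect): - technique_class: explicit-window, zero-counting, cosh-defect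
- Literature.Barriers.RiemannHypothesis.BoundedFluctuationCounting: outside — the barrier (Selberg
1946 S(T) = Ω±; `frequently_zetaZeroCount_lt_of_thetaTerm_sub_le`) forbids counting laws with
BOUNDED fluctuation; here S(t) enters only through the PROVED two-sided explicit remainder |N − M −
7/8| ≤ 0.3083 log t + 4.128 (growing), inside LiCoshTailCount and the inherited LiOscillatoryS; no
bounded-fluctuation hypothesis anywhere [corpus: tree
Literature/Barriers/RiemannHypothesis/BoundedFluctuationCounting.lean].
- Literature.Barriers.RiemannHypothesis.LindelofBacklund / GramRosserFailures: outside — no size ⇒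
zero-free upgrade, no Gram/Rosser law, no Turing method (the plain Backlund form of LiOscillatoryS
is used, not the Turing conjunct); zeros above T enter with multiplicity at ANY real part in [0,1]
(the cosh defect is the worst case Re ρ ∈ {0,1}).
- Literature.Barriers.RiemannHypothesis.NymanBeurlingObstructions / MollifierLimitations /
BerryKeatingOperator / DeBrangesPositivity / JensenPolynomials: not this route's class; the leaf is
labelled NOT evidence for RH (a verified height is consumed, not produced; Li positivity for n ≤ 2T²
log T is exactly what the verified zeros plus counting force, and the dossier's ceiling statement
says no more can be forced).
- Negatives index: `ledger negatives --problem RiemannHypothesis` (2026-08-26): refuted statements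
concern Jacobi-symbol sine sums, de Bruijn universal f

History (route lifecycle, newest last):
- 2026-08-26T14:13:57Z · CLOSED proved — proved:Summit.RiemannHypothesis.RiemannHypothesis.Theorems.LiTheory.liHeightLawLog_holds (operator:999:1355527)

sub-problem: RiemannHypothesis · status: closed(proved) · opened planner-rh-li-theory-g8-0 2026-08-26T12:09:58Z · rev 1 · ledger route-RiemannHypothesis-LiHeightLog
GENERATED by the gate from the ledger (D-0016/17). Provers cite these decls: `theorem foo : Summit.RiemannHypothesis.RiemannHypothesis.Theses.LiHeightLog.<Decl> := …` in Summits/RiemannHypothesis/RiemannHypothesis/Theorems/<Name>.lean.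
-/

namespace Summit.RiemannHypothesis.RiemannHypothesis.Theses.LiHeightLog

open scoped BigOperators Topology Manifold Classical MeasureTheory ProbabilityTheory Matrix InnerProductSpace ComplexConjugate ContinuousMap
open Filter Set Function TopologicalSpace MeasureTheory

attribute [summit_statement] _root_.Summit.RiemannHypothesis
attribute [summit_statement] _root_.Summit.RiemannHypothesis.RiemannHypothesis.Theorems.LiTheory.LiHeightLawLog

open Summit

/-- item stmt-RiemannHypothesis-19647 · crux · rank 2 · closed · proved by Summit.RiemannHypothesis.RiemannHypothesis.Theorems.liCoshTailCount_proof (prover) · by planner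
why it might fail: the IBP needs φ_n(t)(t log t) → 0 and 2φ ≤ −tφ′ uniformly in n (true: cosh s − 1 ≤ s sinh s), and the Stieltjes step over the step function N(t) with the two-sided remainder at ordinates; constants 1.24/18 carry only 0.007 log T + 0.87 of slack over the derivation's 1.2332 log T + 17.13.
sources: Brown2005LiCriterion, doi:10.1016/j.jnt.2004.07.016, paper:w2187263254, arXiv:1807.01506, tree:Literature/NumberTheory/LFunctions/ZetaArgBacklundExplicit.lean, tree:Literature/NumberTheory/LFunctions/SchoenfeldZeroSums.lean
[crux] (N2, deciding, RH-FREE) the COSH TAIL COUNT: for 1000 ≤ T ≤ U and every n, Σ_{ρ ∈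
zerosBetween T U} m(ρ)·liCoshWeight n (Im ρ) ≤ liCoshTail n T, where liCoshWeight n t =
(1+1/t²)^{n/2} + (1+1/t²)^{−n/2} − 2 (Brown's g) and liCoshTail n T = (cosh(n/(2T²)) −
1)·(T(log(T/2π) + 1)/π + 1.24 log T + 18): G_n decreasing with G_n ≤ 2φ_n, φ_n(t) = cosh(n/2t²) − 1,
partial summation (`sum_zerosBetween_le_of_count_le`) against N(t) − N(T) ≤ M(t) − M(T) + 2(0.3083
log t + 4.128) (`abs_zetaZeroCount_sub_main_le_explicit`), then 2φ ≤ −tφ′ and one integration by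
parts (∫_T^∞ 2φM′ ≤ Tφ(T)(log(T/2π)+1)/π). [difficulty: M] -/
@[route_item "route-RiemannHypothesis-LiHeightLog", crux]
def LiCoshTailCount : Prop :=
  ∀ (n : ℕ) (T U : ℝ), 1000 ≤ T → T ≤ U → ∑ ρ ∈ Literature.NumberTheory.LFunctions.SchoenfeldBound.zerosBetween T U, (Literature.NumberTheory.LFunctions.riemannZetaZeroOrder ρ : ℝ) * Summit.RiemannHypothesis.RiemannHypothesis.Theorems.LiTheory.liCoshWeight n ρ.im ≤ Summit.RiemannHypothesis.RiemannHypothesis.Theorems.LiTheory.liCoshTail n T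

-- `LiCoshTailCount` holds: proved by `Summit.RiemannHypothesis.RiemannHypothesis.Theorems.liCoshTailCount_proof` (its module imports this route file, so no `_holds` link can be stated here).

/-- item stmt-RiemannHypothesis-19648 · crux · rank 3 · closed · proved by Summit.RiemannHypothesis.RiemannHypothesis.Theorems.LiTheory.liBoxCosh_proof (prover) · by planner
why it might fail: r² ≤ 1 + 1/γ² needs 0 ≤ Re ρ ≤ 1 threaded from `zerosBetween` membership (as in `liBoxTwoSided_bound`); the common-phase identity arg(1 − 1/ρ) = arg(1 − 1/(1 − ρ̄)) needs principal-branch bookkeeping of `Complex.arg` (safe: Re(1 − 1/ρ) > 0 for |ρ| ≥ 4).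
sources: BombieriLagarias1999, Brown2005LiCriterion, tree:Summits/RiemannHypothesis/RiemannHypothesis/Theorems/LiAsymptoticBoxTwoSidedPair.lean, tree:Summits/RiemannHypothesis/RiemannHypothesis/Theorems/LiAsymptoticLiBoxTwoSided.lean
[crux] (K1⁺) the COSH BOX COMPARISON: under RH up to T (4 ≤ T ≤ T′) and for EVERY n, |Re Σ_{ρ ∈
liZeroBox T′} m(1 − (1 − 1/ρ)ⁿ) − 2Σ_{0 < Im ρ ≤ T′} m f_n(Im ρ)| ≤ Σ_{T < Im ρ ≤ T′} m·liCoshWeight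
n (Im ρ) + (n/2)Σ_{T < Im ρ ≤ T′} m/(Im ρ)³: below T every zero is on the line and contributes m f_n
exactly; above T the reflected pair {ρ, 1 − ρ̄} has moduli r, 1/r (|1 − 1/ρ|·|1 − 1/(1 − ρ̄)| = 1)
and a common phase φ with |φ − θ(γ)| ≤ (Re ρ − ½)²/γ³ (tree angle lemma), so |pair − 2m f_n| ≤ m[(rⁿ
+ r⁻ⁿ − 2) + 2n|φ − θ|] ≤ m[liCoshWeight n γ + n/(2γ³)] (r^{±2} ≤ 1 + 1/γ² for 0 ≤ Re ρ ≤ 1); the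
K1b bookkeeping `re_boxSum_eq` of LiAsymptoticLiBoxTwoSided.lean is reused verbatim. [difficulty: M] -/
@[route_item "route-RiemannHypothesis-LiHeightLog", crux]
def LiBoxCosh : Prop :=
  ∀ (n : ℕ) (T T' : ℝ), Literature.NumberTheory.DiophantineGeometry.RiemannHypothesisUpTo T → 4 ≤ T → T ≤ T' → |(∑ᶠ ρ ∈ Literature.NumberTheory.LFunctions.liZeroBox T', (Literature.NumberTheory.LFunctions.riemannZetaZeroOrder ρ : ℂ) * (1 - (1 - 1 / ρ) ^ n)).re - 2 * ∑ ρ ∈ Literature.NumberTheory.LFunctions.SchoenfeldBound.zerosBetween 0 T', (Literature.NumberTheory.LFunctions.riemannZetaZeroOrder ρ : ℝ) * Summit.RiemannHypothesis.RiemannHypothesis.Theorems.LiTheory.liWindowWeight n ρ.im| ≤ (∑ ρ ∈ Literature.NumberTheory.LFunctions.SchoenfeldBound.zerosBetween T T', (Literature.NumberTheory.LFunctions.riemannZetaZeroOrder ρ : ℝ) * Summit.RiemannHypothesis.RiemannHypothesis.Theorems.LiTheory.liCoshWeight n ρ.im) + (n : ℝ) / 2 * (∑ ρ ∈ Literature.NumberTheory.LFunctions.SchoenfeldBound.zerosBetween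 T T', (Literature.NumberTheory.LFunctions.riemannZetaZeroOrder ρ : ℝ) / ρ.im ^ 3)

-- `LiBoxCosh` holds: proved by `Summit.RiemannHypothesis.RiemannHypothesis.Theorems.LiTheory.liBoxCosh_proof` (its module imports this route file, so no `_holds` link can be stated here).

/-- item stmt-RiemannHypothesis-19650 · crux (kind.auto-crux: conjecture-grade) · rank 1 · closed · proved by Summit.RiemannHypothesis.RiemannHypothesis.Theorems.LiTheory.liHeightLog_assembly_proof (prover) · by planner
why it might fail: auto-crux — conjecture-grade statement (statement references the registered conjecture Summit.RiemannHypothesis.RiemannHypothesis.Theorems.LiTheory.LiAsymptoticLawAllRange); it is open, so it may simply be false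
sources: Lagarias2007LiCoefficients, tree:Summits/RiemannHypothesis/RiemannHypothesis/Theorems/LiAsymptoticAssembly.lean
[assembly] LiBoxCosh → LiCoshTailCount → LiAsymptoticLawAllRange (the all-range asymptotic law: ∀ T
≥ 1000, RH up to T ⇒ ∀ n ≥ 900, |λ_n − liMainTerm n| ≤ 2√n log n + liCoshDefect n T); provable now
from the PROVED items of route LiAsymptotic. -/
@[route_item "route-RiemannHypothesis-LiHeightLog", crux]
def Assembly : Prop :=
  LiBoxCosh → LiCoshTailCount → Summit.RiemannHypothesis.RiemannHypothesis.Theorems.LiTheory.LiAsymptoticLawAllRange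

-- `Assembly` holds: proved by `Summit.RiemannHypothesis.RiemannHypothesis.Theorems.LiTheory.liHeightLog_assembly_proof` (its module imports this route file, so no `_holds` link can be stated here).

/-- item stmt-RiemannHypothesis-19649 · crux · rank 4 · closed · proved by Summit.RiemannHypothesis.RiemannHypothesis.Theorems.liHeightBudgetLog_proof (prover) · by planner
why it might fail: two-variable inequality with cosh(n/2T²) up to T/2, checked only on a float grid (r6_check.py (3): min (main − band − defect)/main = 0.80 at n = 900; main/defect ≥ 100 at n = 2T² log T, T ∈ [10³, 10⁴⁰]); an interval pass could expose a corner near n = 900 or T = 1000.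
sources: Brown2005LiCriterion, Lagarias2007LiCoefficients, tree:Summits/RiemannHypothesis/RiemannHypothesis/Theorems/LiAsymptoticDefs.lean
[crux] (K4″) the closed BUDGET of the logarithmic range: for 1000 ≤ T, 900 ≤ n ≤ 2T² log T, 2√n log
n + liCoshDefect n T < liMainTerm n = (n/2)log n + C₁n (C₁ = −1.1303…); split at n = T²: below, cosh
x − 1 ≤ 0.55x² (x = n/2T² ≤ ½) makes the defect ≤ 0.05(n/T)log T; above, cosh x − 1 ≤ eˣ/2 ≤ T/2 (x
≤ log T) makes it ≤ T²(log T + 1)/(2π)·1.01 against (n/2)log n − 1.14n − 2√n log n ≥ 0.8·T² log T.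
[difficulty: S] -/
@[route_item "route-RiemannHypothesis-LiHeightLog", crux]
def LiHeightBudgetLog : Prop :=
  ∀ (n : ℕ) (T : ℝ), 1000 ≤ T → 900 ≤ n → (n : ℝ) ≤ 2 * T ^ 2 * Real.log T → 2 * Real.sqrt n * Real.log n + Summit.RiemannHypothesis.RiemannHypothesis.Theorems.LiTheory.liCoshDefect n T < Summit.RiemannHypothesis.RiemannHypothesis.Theorems.LiTheory.liMainTerm n

-- `LiHeightBudgetLog` holds: proved by `Summit.RiemannHypothesis.RiemannHypothesis.Theorems.liHeightBudgetLog_proof` (its module imports this route file, so no `_holds` link can be stated here).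

/-! D-0027 §2.1 — DECIDING THEOREM (planner-authored via `route open/edit --closes-file`; by planner-rh-li-theory-g8-0 2026-08-26T12:09:58Z) — ARCHIVED: route closed (proved) 2026-08-26T14:13:55Z; kept so importers keep building:
its hypotheses are this route's items and its conclusion the registered leaf `Summit.RiemannHypothesis.RiemannHypothesis.Theorems.LiTheory.LiHeightLawLog` (rung L-P(P1-log), D-0061) (glue_lint), and it elaborates with this file. -/

-- glue.lean — DECIDING THEOREM of route LiHeightLog (D-0027 §2.1; D-0061 rung shape: concludes the RUNG LEAF
-- `Summit.RiemannHypothesis.RiemannHypothesis.Theorems.LiTheory.LiHeightLawLog` («Li height law, logarithmic range», RH-FREE) BY NAME).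
-- Hypotheses = the three crux decls + the Assembly item; every binder is consumed (BC1: 4 binders; BC6 clean).
-- n ≥ 900: all-range law (Assembly) + budget; n < 900: the tree's `keiperLiCoeff_nonneg_of_riemannHypothesisUpTo`
-- (899 ≤ 2π(T − 4) for T ≥ 1000).
@[closes "route-RiemannHypothesis-LiHeightLog"] theorem closes (h1 : LiBoxCosh) (h2 : LiCoshTailCount) (h3 : LiHeightBudgetLog) (hA : Assembly) :
    Summit.RiemannHypothesis.RiemannHypothesis.Theorems.LiTheory.LiHeightLawLog := by
  intro T hT hRH n hn1 hnlog
  by_cases hn : 900 ≤ n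
  · exact (Summit.RiemannHypothesis.RiemannHypothesis.Theorems.LiTheory.keiperLiCoeff_pos_of_lawAllRange
      (hA h1 h2) hT hRH hn (h3 n T hT hn hnlog)).le
  · rw [not_le] at hn
    refine Literature.NumberTheory.LFunctions.keiperLiCoeff_nonneg_of_riemannHypothesisUpTo hRH hn1 ?_
    have h899 : (n : ℝ) ≤ 899 := by exact_mod_cast Nat.lt_succ_iff.mp hn
    nlinarith [Real.pi_gt_three]

end Summit.RiemannHypothesis.RiemannHypothesis.Theses.LiHeightLog
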